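import Literature.NumberTheory.LFunctions.DivisorLogMomentWindow
import Literature.NumberTheory.LFunctions.DivisorSumCharConvMajorant
import Literature.NumberTheory.LFunctions.DivisorSumCharConvExplicitFormula
import Literature.NumberTheory.LFunctions.DivisorSumCharConvCriticalLine
import Literature.NumberTheory.LFunctions.ConreyIwaniec2002SpacingMechanism
import HarnessLib

/-!
# Conrey–Iwaniec (2002), Corollary 6.3 AS TYPED (all `X ≥ 1`), from the log-free convexity bound

Conrey–Iwaniec, *Spacing of zeros of Hecke L-functions and the class number problem*, Acta Arith.
103 (2002), §6 p. 16 [held text `paper:arxiv-math_0111012` p0016:L97–160]: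

> **Corollary 6.3.** For `Y ≥ 2X ≥ 2` we have
> `Σ_{X ≤ n ≤ Y} τ²(n,χ) n^{-1} ≪ ℒ(Y) log(Y/X) + (q/X)^{1/2}` (6.49), where
> `ℒ(Y) = L(1,χ)(L(1,χ) log Y + |L′(1,χ)|)` (6.50).

The typed named fact `conreyIwaniec2002_corollary63` (`ConreyIwaniec2002SpacingMechanism.lean`) is
this statement with ONE absolute constant for all `X ≥ 1` (the large range `X ≥ q²` is the tree
theorem `ConreyIwaniec2002.corollary63_large`). PROVED HERE: the typed statement follows from the
single classical input

  `LFC`: `∃ C, ∀ q > 1, ∀ χ primitive mod q, ∀ t, |L(½ + it, χ)| ≤ C q^{1/4} (1 + |t|)`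

(the log-free convexity bound on the critical line, a consequence of the smooth approximate
functional equation; taken as a HYPOTHESIS in `conreyIwaniec2002_corollary63_of_logFreeConvexity`).
The printed route ("`R_K(s) ≪ q^{1/2}|s|^{5/6}` on `Re s = ½`", Weyl for `ζ`, hybrid convexity for
`L`, and `∏_{p∣q}(1+p^{-s})^{-1} = O(1)`) is replaced by: (i) the multiplicative MAJORANT
`τ(n,χ)² ≤ (τ∗τ)(n,χ)` (`DivisorSumCharSq.norm_sq_divisorSumChar_le_conv_re`), whose generating
function `ζ(w)²L(w,χ)²` is the `φ`-free part of `R_K` (6.43) — no `ζ(2w)^{-1}`, no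
`∏_{p∣q}(1+p^{-w})^{-1}`, and residue data `L(1,χ)²`, `2L(1,χ)L′(1,χ)` without the `β`-term
`Σ_{p∣q} log p/(p+1)` of (6.45); (ii) the tree's Mellin skeleton for the smoothed sums
`W_f(X) = Σ f(n) n^{-1} e^{-n/X}` with the contour ON `re z = −½`
(`DivisorSumCharSq.explicit_formula_conv`); (iii) the remainder bound from LFC
(`DivisorSumCharSq.critical_line_integral_le_of_logFreeConvexity`); (iv) the smoothing majorant
`𝟙_{[X,Y]}(n) ≤ 6(e^{-n/Y} − e^{-n/A})`, `A = max(X/4, 1)` (`DivisorSumCharSq.sum_Ioc_le_conv`) and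
the divisor log-window `W_d(Y) − W_d(A) ≪ (1 + log Y) log(Y/A)`
(`DivisorSumCharSq.norm_W_dCoeff_window_le`). Line `majorant-critical-line` of the cell
landau-siegel/ls-inputs (SKELETON I6c-typed 670f430e77c42482).

«The programme SEARCHES and TYPES; no claim about Landau–Siegel zeros, Theorems 1–2 of
arXiv:2211.02515 or a repaired Margin232 until a kernel theorem says so.»

## References
* [ConreyIwaniec2002] B. Conrey, H. Iwaniec, Acta Arith. 103 (2002) 259–312: §6 (6.42)–(6.50),
  Corollary 6.3.
* [IwaniecKowalski2004] H. Iwaniec, E. Kowalski, *Analytic Number Theory*, AMS Coll. Publ. 53,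
  Theorem 5.3, Proposition 5.4 (approximate functional equation; the convexity bound).
-/

noncomputable section

open Complex
open scoped LSeries.notation

namespace Literature.NumberTheory.LFunctions

namespace ConreyIwaniec2002

open Literature.NumberTheory.LFunctions.DivisorSumCharSq (W norm_W_dCoeff_window_le sum_Ioc_le_conv
  explicit_formula_conv critical_line_integral_le_of_logFreeConvexity)
open Literature.NumberTheory.LFunctions.ZetaM4 (dCoeff)

/-! ### The assembly -/

/-- **THE TYPED COROLLARY 6.3 FROM ITS FOUR INPUTS** (divisor log-window `h1`, majorant smoothing
`hT1`, explicit formula on the critical line `hT2`, log-free convexity `hT3`, critical-line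
integral `hT4`): `C = 36 C₁ + 36 + 12 C₄ + 6`. [cite: ConreyIwaniec2002, Corollary 6.3 (6.49)] -/
theorem corollary63_of
    (h1 : ∃ C : ℝ, 0 < C ∧ ∀ A B : ℝ, 1 ≤ A → 4 * A ≤ B →
      ‖W dCoeff B - W dCoeff A‖ ≤ C * (1 + Real.log B) * Real.log (B / A))
    (hT1 : ∀ {D : ℕ} (χ : DirichletCharacter ℂ D), χ ^ 2 = 1 →
      ∀ {A B : ℝ}, 0 < A → 4 * A ≤ B → ∀ {M N : ℕ}, A ≤ (M : ℝ) + 1 → (N : ℝ) ≤ B →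
        ∑ n ∈ Finset.Ioc M N, ‖divisorSumChar χ n‖ ^ 2 / (n : ℝ) ≤
          6 * (W (divisorSumChar χ ⍟ divisorSumChar χ) B -
            W (divisorSumChar χ ⍟ divisorSumChar χ) A).re)
    (hT2 : ∀ {D : ℕ} [NeZero D] (χ : DirichletCharacter ℂ D), χ ≠ 1 →
      ∀ {A B : ℝ}, 0 < A → 0 < B →
        W (divisorSumChar χ ⍟ divisorSumChar χ) B - W (divisorSumChar χ ⍟ divisorSumChar χ) A =
          χ.LFunction 1 ^ 2 * (W dCoeff B - W dCoeff A) +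
          (Real.log B - Real.log A) * (2 * χ.LFunction 1 * deriv χ.LFunction 1) +
          (1 / (2 * (Real.pi : ℂ))) * ∫ y : ℝ,
            riemannZeta (1 + ((-(1 / 2 : ℝ) : ℂ) + y * I)) ^ 2 *
              Complex.Gamma ((-(1 / 2 : ℝ) : ℂ) + y * I) *
              ((B : ℂ) ^ ((-(1 / 2 : ℝ) : ℂ) + y * I) - (A : ℂ) ^ ((-(1 / 2 : ℝ) : ℂ) + y * I)) *
              (χ.LFunction (1 + ((-(1 / 2 : ℝ) : ℂ) + y * I)) ^ 2 - χ.LFunction 1 ^ 2))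
    (hT3 : ∃ C : ℝ, 0 < C ∧ ∀ (q : ℕ) [NeZero q], 1 < q → ∀ χ : DirichletCharacter ℂ q,
      χ.IsPrimitive → ∀ t : ℝ,
        ‖χ.LFunction (1 / 2 + t * I)‖ ≤ C * (q : ℝ) ^ (1 / 4 : ℝ) * (1 + |t|))
    (hT4 : (∃ C : ℝ, 0 < C ∧ ∀ (q : ℕ) [NeZero q], 1 < q → ∀ χ : DirichletCharacter ℂ q,
      χ.IsPrimitive → ∀ t : ℝ,
        ‖χ.LFunction (1 / 2 + t * I)‖ ≤ C * (q : ℝ) ^ (1 / 4 : ℝ) * (1 + |t|)) →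
      ∃ C : ℝ, 0 < C ∧ ∀ (q : ℕ) [NeZero q], 1 < q → ∀ χ : DirichletCharacter ℂ q,
        χ.IsPrimitive → ∀ A B : ℝ, 0 < A → A ≤ B →
          ‖(1 / (2 * (Real.pi : ℂ))) * ∫ y : ℝ,
            riemannZeta (1 + ((-(1 / 2 : ℝ) : ℂ) + y * I)) ^ 2 *
              Complex.Gamma ((-(1 / 2 : ℝ) : ℂ) + y * I) *
              ((B : ℂ) ^ ((-(1 / 2 : ℝ) : ℂ) + y * I) - (A : ℂ) ^ ((-(1 / 2 : ℝ) : ℂ) + y * I)) *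
              (χ.LFunction (1 + ((-(1 / 2 : ℝ) : ℂ) + y * I)) ^ 2 - χ.LFunction 1 ^ 2)‖ ≤
            C * Real.sqrt q * A ^ (-(1 / 2 : ℝ))) :
    conreyIwaniec2002_corollary63 := by
  obtain ⟨C₁, hC₁, h1⟩ := h1
  obtain ⟨C₄, hC₄, h4⟩ := hT4 hT3
  refine ⟨36 * C₁ + 36 + 12 * C₄ + 6, by positivity, fun q _ hq χ hprim hquad _ X Y hX hXY => ?_⟩
  have hq1 : 1 < q := by omega
  have hq5 : (5 : ℝ) ≤ q := by exact_mod_cast hq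
  have hX0 : 0 < X := by linarith
  have hY0 : 0 < Y := by linarith
  have hYX : 2 ≤ Y / X := by rw [le_div_iff₀ hX0]; linarith
  have hlogYX : Real.log 2 ≤ Real.log (Y / X) := Real.log_le_log (by norm_num) hYX
  have hlog2 : (1 : ℝ) / 2 < Real.log 2 := by
    have := Real.log_two_gt_d9; linarith
  have hlogYX0 : 0 < Real.log (Y / X) := by linarith
  have hχ2 : χ ^ 2 = 1 := hquad.sq_eq_one
  have hχ1 : χ ≠ 1 := Zhang2022.Lemma31.ne_one_of_isPrimitive χ (by omega) hprim
  -- the typed right-hand side is nonnegative, and `√(q/X) ≥ 1` when `X ≤ q`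
  set L1 : ℝ := ‖χ.LFunction 1‖ with hL1
  set L1' : ℝ := ‖deriv χ.LFunction 1‖ with hL1'
  have hL10 : 0 ≤ L1 := norm_nonneg _
  have hL1'0 : 0 ≤ L1' := norm_nonneg _
  have hcalL : calL χ Y = L1 * (L1 * Real.log Y + L1') := rfl
  have hlogY0 : 0 < Real.log Y := Real.log_pos (by linarith)
  have hcalL0 : 0 ≤ calL χ Y * Real.log (Y / X) := by
    rw [hcalL]; positivity
  have hsq0 : 0 ≤ Real.sqrt (q / X) := Real.sqrt_nonneg _
  have hKpos : 0 ≤ 36 * C₁ + 36 + 12 * C₄ := by positivity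
  -- the integer window
  set M : ℕ := ⌈X⌉₊ - 1 with hM
  set N : ℕ := ⌊Y⌋₊ with hN
  have hceil1 : 1 ≤ ⌈X⌉₊ := Nat.one_le_iff_ne_zero.mpr (by
    intro h; rw [Nat.ceil_eq_zero] at h; linarith)
  have hIcc : Finset.Icc ⌈X⌉₊ ⌊Y⌋₊ = Finset.Ioc M N := by
    rw [hM, hN, ← Finset.Icc_add_one_left_eq_Ioc, Nat.sub_add_cancel hceil1]
  have hM1 : ((M : ℕ) : ℝ) + 1 = (⌈X⌉₊ : ℝ) := by
    rw [hM]; push_cast [Nat.cast_sub hceil1]; ring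
  have hXM : X ≤ (M : ℝ) + 1 := by rw [hM1]; exact Nat.le_ceil X
  have hNB : (N : ℝ) ≤ Y := by rw [hN]; exact Nat.floor_le hY0.le
  rcases lt_or_ge Y 4 with hY4 | hY4
  · -- tiny case `Y < 4`: the sum has at most the terms `n = 1, 2, 3`, each `≤ n`
    have hsmall : ∑ n ∈ Finset.Icc ⌈X⌉₊ ⌊Y⌋₊, ‖divisorSumChar χ n‖ ^ 2 / (n : ℝ) ≤ 6 := by
      have hN3 : ⌊Y⌋₊ ≤ 3 := by
        rw [← Nat.lt_succ_iff]
        exact (Nat.floor_lt hY0.le).mpr (by norm_num; linarith)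
      have hsub : Finset.Icc ⌈X⌉₊ ⌊Y⌋₊ ⊆ Finset.Icc 1 3 :=
        Finset.Icc_subset_Icc hceil1 hN3
      have hterm : ∀ n ∈ Finset.Icc (1 : ℕ) 3,
          ‖divisorSumChar χ n‖ ^ 2 / (n : ℝ) ≤ ((n : ℕ) : ℝ) := by
        intro n hn
        rw [Finset.mem_Icc] at hn
        have hn0 : (0 : ℝ) < n := by exact_mod_cast hn.1
        have hb := Zhang2022.Lemma57.norm_divisorSumChar_le_self χ n
        rw [one_mul] at hb
        rw [div_le_iff₀ hn0]
        have h0 : 0 ≤ ‖divisorSumChar χ n‖ := norm_nonneg _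
        nlinarith
      calc ∑ n ∈ Finset.Icc ⌈X⌉₊ ⌊Y⌋₊, ‖divisorSumChar χ n‖ ^ 2 / (n : ℝ)
          ≤ ∑ n ∈ Finset.Icc 1 3, ‖divisorSumChar χ n‖ ^ 2 / (n : ℝ) :=
            Finset.sum_le_sum_of_subset_of_nonneg hsub fun n _ _ => by positivity
        _ ≤ ∑ n ∈ Finset.Icc (1 : ℕ) 3, ((n : ℕ) : ℝ) := Finset.sum_le_sum hterm
        _ = 6 := by simp [Finset.sum_Icc_succ_top]; norm_num
    have hqX : 1 ≤ Real.sqrt (q / X) := by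
      rw [Real.le_sqrt (by norm_num) (by positivity), one_pow, le_div_iff₀ hX0]
      linarith
    calc ∑ n ∈ Finset.Icc ⌈X⌉₊ ⌊Y⌋₊, ‖divisorSumChar χ n‖ ^ 2 / (n : ℝ) ≤ 6 := hsmall
      _ ≤ (36 * C₁ + 36 + 12 * C₄ + 6) * (0 + 1) := by linarith
      _ ≤ (36 * C₁ + 36 + 12 * C₄ + 6) * (calL χ Y * Real.log (Y / X) + Real.sqrt (q / X)) := by
          gcongr
  -- main case `Y ≥ 4`: the window `(A, B] = (max(X/4,1), Y]`
  set A : ℝ := max (X / 4) 1 with hA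
  have hA1 : 1 ≤ A := le_max_right _ _
  have hA0 : 0 < A := by linarith
  have hAX4 : X / 4 ≤ A := le_max_left _ _
  have hAX : A ≤ X := max_le (by linarith) hX
  have hAB : 4 * A ≤ Y := by
    rw [hA]; rcases le_total (X / 4) 1 with h | h
    · rw [max_eq_right h]; linarith
    · rw [max_eq_left h]; linarith
  have hAB' : A ≤ Y := by linarith
  have hAM : A ≤ (M : ℝ) + 1 := hAX.trans hXM
  have hlogBA : Real.log Y - Real.log A = Real.log (Y / A) := (Real.log_div hY0.ne' hA0.ne').symm
  have hYA : Y / A ≤ 4 * (Y / X) := by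
    rw [div_le_iff₀ hA0, show 4 * (Y / X) * A = (Y / X) * (4 * A) by ring]
    have : X ≤ 4 * A := by linarith
    calc Y = (Y / X) * X := by field_simp
      _ ≤ (Y / X) * (4 * A) := by gcongr
  have hlog4 : Real.log 4 ≤ 2 * Real.log (Y / X) := by
    rw [show (4 : ℝ) = 2 ^ 2 by norm_num, Real.log_pow]; push_cast; linarith
  have hlogBA3 : Real.log (Y / A) ≤ 3 * Real.log (Y / X) := by
    calc Real.log (Y / A) ≤ Real.log (4 * (Y / X)) :=
          Real.log_le_log (div_pos hY0 hA0) hYA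
      _ = Real.log 4 + Real.log (Y / X) := Real.log_mul (by norm_num) (by positivity)
      _ ≤ _ := by linarith
  have hlogBA0 : 0 ≤ Real.log (Y / A) := Real.log_nonneg (by rw [le_div_iff₀ hA0]; linarith)
  have hlogY : 1 ≤ Real.log Y := by
    rw [Real.le_log_iff_exp_le hY0]
    have := Real.exp_one_lt_d9; linarith
  have hlogB1 : 1 + Real.log Y ≤ 2 * Real.log Y := by linarith
  -- smoothing + explicit formula + remainder
  have hsm := hT1 χ hχ2 hA0 hAB hAM hNB
  rw [hIcc]
  refine hsm.trans ?_
  have hWd := h1 A Y hA1 hAB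
  have hrem := h4 q hq1 χ hprim A Y hA0 hAB'
  set Δ : ℂ := W (divisorSumChar χ ⍟ divisorSumChar χ) Y -
      W (divisorSumChar χ ⍟ divisorSumChar χ) A with hΔ
  set E : ℂ := (1 / (2 * (Real.pi : ℂ))) * ∫ y : ℝ,
        riemannZeta (1 + ((-(1 / 2 : ℝ) : ℂ) + y * I)) ^ 2 *
          Complex.Gamma ((-(1 / 2 : ℝ) : ℂ) + y * I) *
          ((Y : ℂ) ^ ((-(1 / 2 : ℝ) : ℂ) + y * I) - (A : ℂ) ^ ((-(1 / 2 : ℝ) : ℂ) + y * I)) *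
          (χ.LFunction (1 + ((-(1 / 2 : ℝ) : ℂ) + y * I)) ^ 2 - χ.LFunction 1 ^ 2) with hE
  have hΔeq : Δ = χ.LFunction 1 ^ 2 * (W dCoeff Y - W dCoeff A) +
      (Real.log Y - Real.log A) * (2 * χ.LFunction 1 * deriv χ.LFunction 1) + E :=
    hT2 χ hχ1 hA0 hY0
  have hΔre : Δ.re ≤ L1 ^ 2 * ‖W dCoeff Y - W dCoeff A‖ +
      Real.log (Y / A) * (2 * L1 * L1') + ‖E‖ := by
    calc Δ.re ≤ ‖Δ‖ := Complex.re_le_norm _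
      _ ≤ ‖χ.LFunction 1 ^ 2 * (W dCoeff Y - W dCoeff A) +
            ((Real.log Y - Real.log A : ℝ) : ℂ) * (2 * χ.LFunction 1 * deriv χ.LFunction 1)‖ +
            ‖E‖ := by
          rw [hΔeq]; push_cast; exact norm_add_le _ _
      _ ≤ ‖χ.LFunction 1 ^ 2 * (W dCoeff Y - W dCoeff A)‖ +
            ‖((Real.log Y - Real.log A : ℝ) : ℂ) * (2 * χ.LFunction 1 * deriv χ.LFunction 1)‖ +
            ‖E‖ := by
          gcongr; exact norm_add_le _ _
      _ = _ := by
          rw [norm_mul, norm_mul, norm_pow, Complex.norm_real, hlogBA, Real.norm_eq_abs,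
            abs_of_nonneg hlogBA0, norm_mul, norm_mul, Complex.norm_ofNat]
  -- the remainder in the typed shape `√(q/X)`
  have hrpow : A ^ (-(1 / 2 : ℝ)) ≤ 2 * (Real.sqrt X)⁻¹ := by
    have h1 : A ^ (-(1 / 2 : ℝ)) ≤ (X / 4) ^ (-(1 / 2 : ℝ)) :=
      Real.rpow_le_rpow_of_nonpos (by positivity) hAX4 (by norm_num)
    refine h1.trans (le_of_eq ?_)
    rw [Real.rpow_neg (by positivity), ← Real.sqrt_eq_rpow, Real.sqrt_div' X (by norm_num),
      show Real.sqrt (4 : ℝ) = 2 by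
        rw [show (4 : ℝ) = 2 ^ 2 by norm_num, Real.sqrt_sq (by norm_num)]]
    have hsX : 0 < Real.sqrt X := Real.sqrt_pos.mpr hX0
    field_simp
  have hsqrt : Real.sqrt q * (Real.sqrt X)⁻¹ = Real.sqrt (q / X) := by
    rw [Real.sqrt_div' _ hX0.le, div_eq_mul_inv]
  have hE' : ‖E‖ ≤ 2 * C₄ * Real.sqrt (q / X) := by
    calc ‖E‖ ≤ C₄ * Real.sqrt q * A ^ (-(1 / 2 : ℝ)) := hrem
      _ ≤ C₄ * Real.sqrt q * (2 * (Real.sqrt X)⁻¹) := by gcongr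
      _ = 2 * C₄ * (Real.sqrt q * (Real.sqrt X)⁻¹) := by ring
      _ = 2 * C₄ * Real.sqrt (q / X) := by rw [hsqrt]
  -- term 1: `L1² ‖W_d(B) − W_d(A)‖ ≤ L1² · C₁ · 2 log Y · 3 log(Y/X)`
  have hT1' : L1 ^ 2 * ‖W dCoeff Y - W dCoeff A‖ ≤
      6 * C₁ * (L1 ^ 2 * Real.log Y) * Real.log (Y / X) := by
    calc L1 ^ 2 * ‖W dCoeff Y - W dCoeff A‖
        ≤ L1 ^ 2 * (C₁ * (1 + Real.log Y) * Real.log (Y / A)) :=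
          mul_le_mul_of_nonneg_left hWd (sq_nonneg _)
      _ ≤ L1 ^ 2 * (C₁ * (2 * Real.log Y) * (3 * Real.log (Y / X))) := by gcongr
      _ = _ := by ring
  -- term 2: `log(B/A) · 2 L1 L1' ≤ 6 log(Y/X) L1 L1'`
  have hT2' : Real.log (Y / A) * (2 * L1 * L1') ≤ 6 * Real.log (Y / X) * (L1 * L1') := by
    calc Real.log (Y / A) * (2 * L1 * L1') ≤ (3 * Real.log (Y / X)) * (2 * L1 * L1') :=
          mul_le_mul_of_nonneg_right hlogBA3 (by positivity)
      _ = _ := by ring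
  have hmain : Δ.re ≤ (6 * C₁ + 6) * (calL χ Y * Real.log (Y / X)) +
      2 * C₄ * Real.sqrt (q / X) := by
    have := add_le_add (add_le_add hT1' hT2') hE'
    have e : (6 * C₁ + 6) * (L1 * (L1 * Real.log Y + L1') * Real.log (Y / X)) =
        6 * C₁ * (L1 ^ 2 * Real.log Y) * Real.log (Y / X) + 6 * Real.log (Y / X) * (L1 * L1') +
          (6 * C₁ * (L1 * L1' * Real.log (Y / X)) + 6 * (L1 ^ 2 * Real.log Y * Real.log (Y / X))) := by
      ring
    have hP : 0 ≤ 6 * C₁ * (L1 * L1' * Real.log (Y / X)) +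
        6 * (L1 ^ 2 * Real.log Y * Real.log (Y / X)) := by positivity
    rw [hcalL]; linarith [hΔre]
  calc 6 * Δ.re ≤ 6 * ((6 * C₁ + 6) * (calL χ Y * Real.log (Y / X)) +
        2 * C₄ * Real.sqrt (q / X)) := by gcongr
    _ = (36 * C₁ + 36) * (calL χ Y * Real.log (Y / X)) + 12 * C₄ * Real.sqrt (q / X) := by ring
    _ ≤ (36 * C₁ + 36 + 12 * C₄ + 6) * (calL χ Y * Real.log (Y / X)) +
          (36 * C₁ + 36 + 12 * C₄ + 6) * Real.sqrt (q / X) :=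
        add_le_add (mul_le_mul_of_nonneg_right (by linarith) hcalL0)
          (mul_le_mul_of_nonneg_right (by linarith) hsq0)
    _ = (36 * C₁ + 36 + 12 * C₄ + 6) * (calL χ Y * Real.log (Y / X) + Real.sqrt (q / X)) := by
        ring


end ConreyIwaniec2002

open ConreyIwaniec2002

/-- **CONREY–IWANIEC (2002), COROLLARY 6.3 AS TYPED, FROM THE LOG-FREE CONVEXITY BOUND.** If
`|L(½ + it, χ)| ≤ C q^{1/4}(1 + |t|)` for all primitive `χ` modulo `q > 1` and all real `t`
(one absolute `C`), then `conreyIwaniec2002_corollary63` holds: for `q > 4`, `χ` primitive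
quadratic odd mod `q`, `Y ≥ 2X ≥ 2`,
`Σ_{⌈X⌉ ≤ n ≤ ⌊Y⌋} |τ(n,χ)|²/n ≤ C′(ℒ(Y) log(Y/X) + √(q/X))`.
[cite: ConreyIwaniec2002, Corollary 6.3 (6.49)] -/
theorem conreyIwaniec2002_corollary63_of_logFreeConvexity
    (hLFC : ∃ C : ℝ, 0 < C ∧ ∀ (q : ℕ) [NeZero q], 1 < q → ∀ χ : DirichletCharacter ℂ q,
      χ.IsPrimitive → ∀ t : ℝ,
        ‖χ.LFunction (1 / 2 + t * I)‖ ≤ C * (q : ℝ) ^ (1 / 4 : ℝ) * (1 + |t|)) :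
    conreyIwaniec2002_corollary63 :=
  corollary63_of DivisorSumCharSq.norm_W_dCoeff_window_le
    (fun χ hχ _ _ hA hAB _ _ hM hN => DivisorSumCharSq.sum_Ioc_le_conv χ hχ hA hAB hM hN)
    (fun χ hχ1 _ _ hA hB => DivisorSumCharSq.explicit_formula_conv χ hχ1 hA hB)
    hLFC DivisorSumCharSq.critical_line_integral_le_of_logFreeConvexity

end Literature.NumberTheory.LFunctions

end
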